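import Mathlib
import Summits.ValiantsHypothesis.ValiantsHypothesis.Theorems.FreeSubtorusConfusionCoveringClassCount
import Summits.ValiantsHypothesis.ValiantsHypothesis.Theorems.FreeSubtorusConfusionCoveringDial
import Literature.Barriers.ValiantsHypothesis.ShiftedPartialsCaseC2

/-!
# `OrbitDimensionBound` (stmt-ValiantsHypothesis-16133), rung line `quadratic_covering` — stub `stub_windowCount`

The line `Cruxes/OrbitDimensionBound/Lines/quadratic_covering.lean` (route `FreeSubtorus`, rung `Degree.QuadraticShadow`,
entry-degree dial `δ`) has three registered stubs: `stub_gradedLift` (LANDED, p595633), `stub_windowWeights` (the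
load-bearing long-edge Leibniz/flow statement, OPEN) and the bookkeeping count proved here,

  `stub_windowCount : Stmt.stub_windowCount` (statement copied verbatim; no local vocabulary to unfold):

**WINDOW PIGEONHOLE.**  If every permutation `σ ∈ 𝔖_n` is SERVED by a pair `(I, σI)` with `⌊n/2⌋ + 1 − δ ≤ |I| ≤ ⌊n/2⌋`
whose weight `γ₀ · d^I · e^{σI}` (`γ₀ ≠ 0`) has a non-zero generalised eigenspace for the `m × m` matrix `g`, and the
characters of `(d, e)` separate exactly modulo the saturation of `ℤΛ` (`Λ` with zero ROW sums, `r` generators), then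
`C(n, ⌊n/2⌋ + 1 − δ) ≤ m · 2^r`.

**Proof** (the `δ = 1` case is the tree's `stub_classCount` + Odlyzko, `FreeSubtorusConfusionCoveringClassCount.lean` /
`…Dial.lean`; we run the same argument on a WINDOW of levels).  Let `W` be the set of pairs `(I, J)`, `|I| = |J|` in the
window, whose weight occurs.  (1) PIGEONHOLE: every `σ` is induced by some pair of `W` with `σ(I) = J`, and a pair of
level `t` induces at most `t!(n−t)! ≤ lo!(n−lo)!` permutations (`lo = ⌊n/2⌋+1−δ ≤ t ≤ ⌊n/2⌋`; `s ↦ s!(n−s)!` decreases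
on `[0, ⌊n/2⌋]`, i.e. `C(n,lo) ≤ C(n,t)`, tree `Literature.Barriers.ValiantsHypothesis.choose_le_choose_of_le_half`), so
`C(n, lo) ≤ |W|`.
(2) At most `m` weights occur (independent generalised eigenspaces of `g` in `ℂ^m`).  (3) Two pairs of `W` with the SAME
weight have a character relation `d^{I−I'} e^{J−J'} = 1` (`char_eq_one_of_wt_eq`), hence by exact separation their
indicator characters are congruent modulo `span_ℚ Λ` — they are CONFUSED — and, the row sums of `Λ` being zero, they have
the SAME LEVEL; so a weight class of `W` lies in one confusion class at one level, of size `≤ κ_t(Λ) ≤ 2^r`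
(`card_confusedClass_le_two_pow`, Odlyzko 1988).  Hence `|W| ≤ m · 2^r`.

Helper mode (`--supports stmt-ValiantsHypothesis-16133 --as helper`): the registered skeleton of the item is
`affine_multiple`, so no stub credit moves.  Honest framing: a bookkeeping count of a rung line whose core
`stub_windowWeights` is OPEN; the crux `OrbitDimensionBound`, the route `FreeSubtorus` and VP ≠ VNP are OPEN and NOT moved
by this file.

## References
* [LandsbergRessayre2017] J. M. Landsberg, N. Ressayre, *Permanent v. determinant: an exponential lower bound assuming
  symmetry and a potential path towards Valiant's conjecture*, Differential Geom. Appl. 55 (2017), Thm. 2.8, §6.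
* [Odlyzko1988] A. M. Odlyzko, *On subspaces spanned by random selections of ±1 vectors*, J. Combin. Theory Ser. A 47
  (1988), p. 127 (a translate of an `r`-dimensional subspace holds `≤ 2^r` hypercube points).
-/

open Finset
open Summit.ValiantsHypothesis.ValiantsHypothesis.Theorems.FreeSubtorusConfusionCovering

-- the mandated summit-side namespace repeats a component by design (single-problem summit)
set_option linter.dupNamespace false

namespace Summit.ValiantsHypothesis.ValiantsHypothesis.Theorems.FreeSubtorusOrbitDimensionBound.QuadraticCovering

noncomputable section

/-! ### §1 The window factorials: `s ↦ s!(n−s)!` decreases on `[0, ⌊n/2⌋]` -/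

/-- `t!(n−t)! ≤ lo!(n−lo)!` for `lo ≤ t ≤ ⌊n/2⌋`. [folklore] -/
theorem factorial_mul_factorial_le {n lo t : ℕ} (hlo : lo ≤ t) (ht : t ≤ n / 2) :
    t.factorial * (n - t).factorial ≤ lo.factorial * (n - lo).factorial := by
  have htn : t ≤ n := ht.trans (Nat.div_le_self n 2)
  have hlon : lo ≤ n := hlo.trans htn
  have hpos : 0 < n.choose lo := Nat.choose_pos hlon
  refine Nat.le_of_mul_le_mul_left ?_ hpos
  calc n.choose lo * (t.factorial * (n - t).factorial)
      ≤ n.choose t * (t.factorial * (n - t).factorial) :=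
        Nat.mul_le_mul_right _ (Literature.Barriers.ValiantsHypothesis.choose_le_choose_of_le_half hlo ht)
    _ = n.factorial := by rw [← mul_assoc, Nat.choose_mul_factorial_mul_factorial htn]
    _ = n.choose lo * (lo.factorial * (n - lo).factorial) := by
        rw [← mul_assoc, Nat.choose_mul_factorial_mul_factorial hlon]

/-! ### §2 The stub -/

open Classical in
/-- **Stub `stub_windowCount` of the line `quadratic_covering`** (statement = the line's `Stmt.stub_windowCount` verbatim):
window pigeonhole — served pairs in the window `[⌊n/2⌋+1−δ, ⌊n/2⌋]`, exact separation modulo `sat(ℤΛ)` with zero row sums,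
an `m × m` matrix `g` ⇒ `C(n, ⌊n/2⌋+1−δ) ≤ m · 2^r`.  At `δ = 1` this is the tree's `stub_classCount` + Odlyzko.
[cite: LandsbergRessayre2017, §6] [cite: Odlyzko1988, p. 127] -/
theorem stub_windowCount :
    ∀ (δ n m r : ℕ) (Λ : Fin r → (Fin n ⊕ Fin n) → ℤ) (d e : Fin n → ℂˣ) (γ₀ : ℂ) (g : Matrix (Fin m) (Fin m) ℂ),
    γ₀ ≠ 0 → (∀ i, (∑ k, Λ i (Sum.inl k)) = 0) →
    (∀ χ : (Fin n ⊕ Fin n) → ℤ,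
      (∏ k, (d k) ^ (χ (Sum.inl k))) * (∏ l, (e l) ^ (χ (Sum.inr l))) = 1 →
      ∃ (N : ℤ) (a : Fin r → ℤ), N ≠ 0 ∧ N • χ = ∑ i, a i • Λ i) →
    (∀ σ : Equiv.Perm (Fin n), ∃ I : Finset (Fin n), n / 2 + 1 - δ ≤ I.card ∧ I.card ≤ n / 2 ∧
      Module.End.maxGenEigenspace (Matrix.toLin' g) (γ₀ * ∏ k ∈ I, ((d k : ℂ) * (e (σ k) : ℂ))) ≠ ⊥) →
    Nat.choose n (n / 2 + 1 - δ) ≤ m * 2 ^ r := by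
  intro δ n m r Λ d e γ₀ g hγ₀ hrow hsep hserved
  classical
  -- notation
  set lvl := n / 2 with hlvl
  set lo := n / 2 + 1 - δ with hlo
  -- `δ = 0`: the window is empty, the hypothesis is contradictory
  rcases Nat.eq_zero_or_pos δ with hδ | hδ
  · exfalso
    obtain ⟨I, h1, h2, -⟩ := hserved 1
    omega
  have hlolvl : lo ≤ lvl := by omega
  set ind : Finset (Fin n) × Finset (Fin n) → (Fin n ⊕ Fin n) → ℤ := fun p =>
    Sum.elim (fun k => if k ∈ p.1 then (1 : ℤ) else 0) (fun l => if l ∈ p.2 then (1 : ℤ) else 0) with hind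
  set Conf : Finset (Fin n) × Finset (Fin n) → Finset (Fin n) × Finset (Fin n) → Prop := fun p q =>
    ∃ c : Fin r → ℚ, ∀ x : Fin n ⊕ Fin n, ((ind p x : ℤ) : ℚ) - ((ind q x : ℤ) : ℚ) = ∑ i, c i * ((Λ i x : ℤ) : ℚ)
    with hConf
  set wt : Finset (Fin n) × Finset (Fin n) → ℂ := fun p =>
    γ₀ * ((∏ k ∈ p.1, (d k : ℂ)) * ∏ l ∈ p.2, (e l : ℂ)) with hwt
  set E : ℂ → Submodule ℂ (Fin m → ℂ) := fun β => Module.End.maxGenEigenspace (Matrix.toLin' g) β with hE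
  -- the served pairs of the window whose weight occurs
  set W : Finset (Finset (Fin n) × Finset (Fin n)) :=
    univ.filter fun p => lo ≤ p.1.card ∧ p.1.card ≤ lvl ∧ p.2.card = p.1.card ∧ E (wt p) ≠ ⊥ with hW
  -- Step 1: `C(n, lo) ≤ |W|` (pigeonhole over `𝔖_n`)
  have h1 : n.choose lo ≤ W.card := by
    choose I hIlo hIlvl hEI using hserved
    let f : Equiv.Perm (Fin n) → Finset (Fin n) × Finset (Fin n) := fun σ => (I σ, (I σ).map σ.toEmbedding)
    have hf : ∀ σ ∈ (univ : Finset (Equiv.Perm (Fin n))), f σ ∈ W := fun σ _ => by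
      simp only [hW, mem_filter, mem_univ, true_and, f]
      refine ⟨hIlo σ, hIlvl σ, card_map _, ?_⟩
      have : wt (I σ, (I σ).map σ.toEmbedding) = γ₀ * ∏ k ∈ I σ, ((d k : ℂ) * (e (σ k) : ℂ)) := by
        simp only [hwt, Finset.prod_map, Equiv.coe_toEmbedding, Finset.prod_mul_distrib]
      rw [this]
      exact hEI σ
    have hfib : ∀ b ∈ W, (univ.filter fun σ => f σ = b).card ≤ lo.factorial * (n - lo).factorial := by
      rintro ⟨I₀, J₀⟩ hb
      have hI₀lo : lo ≤ I₀.card := (mem_filter.1 hb).2.1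
      have hI₀lvl : I₀.card ≤ lvl := (mem_filter.1 hb).2.2.1
      calc (univ.filter fun σ => f σ = (I₀, J₀)).card
          ≤ (univ.filter fun σ : Equiv.Perm (Fin n) => I₀.map σ.toEmbedding = J₀).card := by
            refine card_le_card fun σ hσ => ?_
            simp only [mem_filter, mem_univ, true_and, f, Prod.mk.injEq] at hσ ⊢
            rw [← hσ.1]
            exact hσ.2
        _ ≤ I₀.card.factorial * (n - I₀.card).factorial :=
            BorderApolarityToricWitnessObstructionQP.torusBound_card_perm_map_le I₀ J₀
        _ ≤ lo.factorial * (n - lo).factorial := factorial_mul_factorial_le hI₀lo hI₀lvl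
    have hcount := card_le_mul_card_image_of_maps_to hf _ hfib
    rw [card_univ, Fintype.card_perm, Fintype.card_fin] at hcount
    have hlon : lo ≤ n := hlolvl.trans (Nat.div_le_self n 2)
    refine Nat.le_of_mul_le_mul_right ?_ (Nat.mul_pos (Nat.factorial_pos lo) (Nat.factorial_pos (n - lo)))
    calc n.choose lo * (lo.factorial * (n - lo).factorial) = n.factorial := by
          rw [← mul_assoc, Nat.choose_mul_factorial_mul_factorial hlon]
      _ ≤ lo.factorial * (n - lo).factorial * W.card := hcount
      _ = W.card * (lo.factorial * (n - lo).factorial) := mul_comm _ _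
  -- Step 2a: at most `m` weights occur
  set Ω := W.image wt with hΩ
  have h2a : Ω.card ≤ m := by
    have hind' : iSupIndep (fun ω : ↥Ω => E (ω : ℂ)) :=
      (Module.End.independent_maxGenEigenspace (Matrix.toLin' g)).comp Subtype.val_injective
    have hne : ∀ ω : ↥Ω, (fun ω : ↥Ω => E (ω : ℂ)) ω ≠ ⊥ := by
      rintro ⟨ω, hω⟩
      obtain ⟨p, hp, rfl⟩ := mem_image.1 hω
      exact (mem_filter.1 hp).2.2.2.2
    have := hind'.subtype_ne_bot_le_finrank
    rwa [Fintype.card_congr (Equiv.subtypeUnivEquiv hne), Fintype.card_coe, Module.finrank_fin_fun] at this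
  -- Step 2b: a weight class of `W` lies in ONE confusion class at ONE level
  have h2b : ∀ ω ∈ Ω, (W.filter fun p => wt p = ω).card ≤ 2 ^ r := by
    intro ω hω
    obtain ⟨q, hq, rfl⟩ := mem_image.1 hω
    have hqW := (mem_filter.1 hq).2
    set t := q.1.card with ht
    have hq2 : q.2.card = t := hqW.2.2.1
    -- the weight class is inside the level-`t` confusion class of `q`
    refine le_trans (card_le_card fun p hp => ?_) (card_confusedClass_le_two_pow n r t Λ q)
    have hpW := (mem_filter.1 (mem_filter.1 hp).1).2
    have hpq : wt p = wt q := (mem_filter.1 hp).2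
    -- exact separation: the two pairs are confused
    have hprod : (∏ k ∈ p.1, (d k : ℂ)) * (∏ l ∈ p.2, (e l : ℂ)) = (∏ k ∈ q.1, (d k : ℂ)) * ∏ l ∈ q.2, (e l : ℂ) :=
      mul_left_cancel₀ hγ₀ hpq
    obtain ⟨N, a, hN, hNa⟩ := hsep (ind p - ind q) (by
      have := char_eq_one_of_wt_eq d e p q hprod
      simpa only [hind, Pi.sub_apply] using this)
    have hconf : ∀ x : Fin n ⊕ Fin n,
        ((ind p x : ℤ) : ℚ) - ((ind q x : ℤ) : ℚ) = ∑ i, ((a i : ℚ) / N) * ((Λ i x : ℤ) : ℚ) := by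
      intro x
      have hx := congrFun hNa x
      simp only [Pi.smul_apply, Finset.sum_apply, smul_eq_mul, Pi.sub_apply] at hx
      have hxQ : (N : ℚ) * (((ind p x : ℤ) : ℚ) - ((ind q x : ℤ) : ℚ)) = ∑ i, (a i : ℚ) * ((Λ i x : ℤ) : ℚ) := by
        exact_mod_cast hx
      have hNQ : (N : ℚ) ≠ 0 := by exact_mod_cast hN
      have hdiv : ((ind p x : ℤ) : ℚ) - ((ind q x : ℤ) : ℚ) = (∑ i, (a i : ℚ) * ((Λ i x : ℤ) : ℚ)) / N :=
        (eq_div_iff hNQ).2 (by rw [mul_comm]; exact hxQ)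
      rw [hdiv, Finset.sum_div]
      exact Finset.sum_congr rfl fun i _ => by ring
    -- zero row sums: confused pairs have the same level
    have hlevel : p.1.card = t := by
      have hsum := congrArg (fun v : (Fin n ⊕ Fin n) → ℤ => ∑ k, v (Sum.inl k)) hNa
      simp only [Pi.smul_apply, Finset.sum_apply, smul_eq_mul, Pi.sub_apply] at hsum
      have hΛ0 : ∑ k : Fin n, ∑ i, a i * Λ i (Sum.inl k) = 0 := by
        rw [Finset.sum_comm]
        refine Finset.sum_eq_zero fun i _ => ?_
        rw [← Finset.mul_sum, hrow i, mul_zero]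
      rw [hΛ0, ← Finset.mul_sum, mul_eq_zero] at hsum
      rcases hsum with hN0 | hsum
      · exact absurd hN0 hN
      · have hp1 : ∑ k : Fin n, ind p (Sum.inl k) = p.1.card := by
          simp [hind, Finset.sum_ite_mem, Finset.univ_inter]
        have hq1 : ∑ k : Fin n, ind q (Sum.inl k) = q.1.card := by
          simp [hind, Finset.sum_ite_mem, Finset.univ_inter]
        rw [Finset.sum_sub_distrib, hp1, hq1] at hsum
        omega
    refine mem_filter.2 ⟨mem_univ _, hlevel, hpW.2.2.1.trans hlevel, fun i => (a i : ℚ) / N, fun x => ?_⟩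
    simpa only [hind] using hconf x
  -- Step 2c: sum over the weights
  have h2 : W.card ≤ m * 2 ^ r := by
    rw [Finset.card_eq_sum_card_image wt W]
    calc ∑ ω ∈ Ω, (W.filter fun p => wt p = ω).card ≤ ∑ _ω ∈ Ω, 2 ^ r := Finset.sum_le_sum h2b
      _ = Ω.card * 2 ^ r := by rw [Finset.sum_const, smul_eq_mul]
      _ ≤ m * 2 ^ r := Nat.mul_le_mul_right _ h2a
  exact h1.trans h2

end

end Summit.ValiantsHypothesis.ValiantsHypothesis.Theorems.FreeSubtorusOrbitDimensionBound.QuadraticCovering
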